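import Literature.Computability.AlgebraicComplexity.SchonhageRectangular
import Literature.Computability.AlgebraicComplexity.AsymptoticRankLimit
import Literature.Computability.AlgebraicComplexity.RectangularExponentAsymptoticRank
import Literature.Computability.AlgebraicComplexity.AsymptoticRankMultiples
import HarnessLib

/-!
# `R̃(⊕^t ⟨k,m,n⟩) = t · R̃(⟨k,m,n⟩)` and Schönhage's rectangular asymptotic sum inequality in the
generality printed by Alman–Duan–Vassilevska Williams–Xu–Xu–Zhou 2025 (Thm. 3.2) — proved

Topic `Literature/Computability/AlgebraicComplexity`.  Theorem 3.2 of Alman–Duan–Vassilevska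
Williams–Xu–Xu–Zhou, *More asymmetry yields faster matrix multiplication* (SODA 2025,
arXiv:2404.16349, §3.5, "Asymptotic Sum Inequality for `ω(a,b,c)` [Schönhage81]"):

> Let `t, q > 0` be positive integers and `a, b, c ≥ 0`, then
> `t · q^{ω(a,b,c)} ≤ R̃(⊕_{i=1}^t ⟨q^a, q^b, q^c⟩)`.

The tree had this for the formats `(1,1,k)` / `(1,k,1)` (`SchonhageRectangular.lean`, real `k`, the
form consumed by the laser-method certificates).  Here it is PROVED for all three exponents
(natural `a, b, c`, so that `q^a, q^b, q^c` are honest dimensions; `q ≥ 2`), as a consequence of an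
identity about matrix multiplication tensors of ANY format which is the real content of
Schönhage's equal-summand argument:

* `mul_asymptoticRank_matMulTensor_le` — **`t · R̃(⟨k,m,n⟩) ≤ R̃(⟨t⟩ ⊗ ⟨k,m,n⟩)`** (`t, k, m, n ≥ 1`),
  hence `asymptoticRank_multiple_matMulTensor` — **`R̃(⟨t⟩ ⊗ ⟨k,m,n⟩) = t · R̃(⟨k,m,n⟩)`** (with
  the easy `R̃(⟨t⟩ ⊗ s) ≤ t R̃(s)` of `AsymptoticRankMultiples.lean`): the asymptotic rank is
  additive on copies of a matrix multiplication tensor;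
* `advxxz2025_thm32` — **Thm. 3.2**: `t · q^{ω(a,b,c)} ≤ R̃(⟨t⟩ ⊗ ⟨q^a,q^b,q^c⟩)`, indeed with
  equality (`advxxz2025_thm32_eq`), by `R̃(⟨q^a,q^b,q^c⟩) = q^{ω(a,b,c)}`
  (`asymptoticRank_matMulTensor_rect`, `RectangularExponentAsymptoticRank.lean`); and the cubic
  case `R̃(⟨t⟩ ⊗ ⟨q,q,q⟩) = t · q^ω` (`asymptoticRank_multiple_matMulTensor_cube`).

## Proof of `t · R̃(T) ≤ R̃(U)`, `T = ⟨k,m,n⟩`, `U = ⟨t⟩ ⊗ T`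

Fix `N ≥ 1`, `r_N = R(U^{⊗N})`, `Q_N = ⌈r_N / t^N⌉`.  Since `U^{⊗N} ≥ ⟨t^N⟩ ⊗ ⟨k^N,m^N,n^N⟩`
(`tensorRestrictsTo_kroneckerPow_multiple_matMulTensor`), `R(t^N ⊙ ⟨k^N,m^N,n^N⟩) ≤ Q_N t^N`, and
the claim in the proof of Bläser 2013, Lemma 7.7 (`Blaser2013_lemma77_claim`) gives
`R(T^{⊗N(s+1)}) = R(⟨k^{N(s+1)},…⟩) ≤ R(t^N ⊙ ⟨(k^N)^{s+1},…⟩) ≤ Q_N^{s+1} t^N` for all `s`, so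
`R̃(T) ≤ Q_N^{1/N} t^{1/(s+1)} → Q_N^{1/N}` (`s → ∞`).  By flattening `r_N ≥ t^N`
(`le_tensorRank_multiple`), so `Q_N ≤ 2 r_N / t^N` and `R̃(T) ≤ 2^{1/N} r_N^{1/N} / t → R̃(U)/t`
(`N → ∞`, Fekete: `advxxz2025_asymptoticRank_tendsto`).  Everything is proved; no definitions, no
named facts.

## References

* J. Alman, R. Duan, V. Vassilevska Williams, Y. Xu, Z. Xu, R. Zhou, *More asymmetry yields faster
  matrix multiplication*, SODA 2025, arXiv:2404.16349, §3.5 Thm. 3.2; §3.2 (`R̃`, Fekete); §3.4.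
  [AlmanDuanVassilevskaWilliamsXuXuZhou2025]
* M. Bläser, *Fast Matrix Multiplication*, Theory of Computing Graduate Surveys 5 (2013), Lemma 7.1 (2),
  Lemma 7.7 (proof) and Thm. 7.5. [Blaser2013]
* A. Schönhage, *Partial and total matrix multiplication*, SIAM J. Comput. 10 (1981) 434–455, Thm. 7.1.
-/

noncomputable section

open Filter Topology

namespace Literature.Computability.AlgebraicComplexity

open Literature.Barriers.MatrixMultiplication (asymptoticRank_le_rpow)

section MultiplesMatMul

variable (K : Type) [Field K]

/-- A matrix multiplication tensor with positive dimensions has a non-zero entry (the product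
`Z₁₁ ∋ X₁₁ Y₁₁`). [folklore] -/
theorem matMulTensor_apply_zero_ne_zero {k m n : ℕ} (hk : 0 < k) (hm : 0 < m) (hn : 0 < n) :
    matMulTensor K k m n (⟨0, hk⟩, ⟨0, hn⟩) (⟨0, hk⟩, ⟨0, hm⟩) (⟨0, hm⟩, ⟨0, hn⟩) ≠ 0 := by
  simp [matMulTensor]

/-- **Flattening for the powers of `U = ⟨t⟩ ⊗ ⟨k,m,n⟩`: `t^N ≤ R(U^{⊗N})`** (`k, m, n ≥ 1`), through
`U^{⊗N} ≥ ⟨t^N⟩ ⊗ ⟨k^N, m^N, n^N⟩` and Bläser's `f ≤ R(f ⊙ s)` for `s ≠ 0`.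
[cite: Blaser2013, Lemma 7.1 (2)] -/
theorem pow_le_tensorRank_kroneckerPow_multiple_matMulTensor {k m n : ℕ} (hk : 0 < k) (hm : 0 < m)
    (hn : 0 < n) (t N : ℕ) :
    t ^ N ≤ tensorRank (kroneckerPow (kroneckerTensor (unitTensor K t) (matMulTensor K k m n)) N) := by
  have hres := tensorRestrictsTo_kroneckerPow_multiple_matMulTensor (K := K) t k m n N
  refine le_trans ?_ hres.tensorRank_le
  exact le_tensorRank_multiple (t ^ N) _
    (matMulTensor_apply_zero_ne_zero K (pow_pos hk N) (pow_pos hm N) (pow_pos hn N))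

/-- **The claim of Bläser's Lemma 7.7 applied to a power of `U = ⟨t⟩ ⊗ ⟨k,m,n⟩`**: if
`R(U^{⊗N}) ≤ Q · t^N` then `R(⟨k,m,n⟩^{⊗ N(s+1)}) ≤ Q^{s+1} · t^N` for every `s`
(`U^{⊗N} ≥ t^N ⊙ ⟨k^N,m^N,n^N⟩`, the claim, and `⟨k,m,n⟩^{⊗N(s+1)} ≅ ⟨(k^N)^{s+1}, …⟩ ≤ t^N ⊙ ⟨…⟩`).
[cite: Blaser2013, Lemma 7.7 (proof)] -/
theorem tensorRank_kroneckerPow_matMulTensor_le_of_multiple {t k m n N Q : ℕ} (ht : 1 ≤ t)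
    (hQ : tensorRank (kroneckerPow (kroneckerTensor (unitTensor K t) (matMulTensor K k m n)) N) ≤
      Q * t ^ N) (s : ℕ) :
    tensorRank (kroneckerPow (matMulTensor K k m n) (N * (s + 1))) ≤ Q ^ (s + 1) * t ^ N := by
  have h0 : tensorRank (kroneckerTensor (unitTensor K (t ^ N))
      (matMulTensor K (k ^ N) (m ^ N) (n ^ N))) ≤ Q * t ^ N :=
    (tensorRestrictsTo_kroneckerPow_multiple_matMulTensor (K := K) t k m n N).tensorRank_le.trans hQ
  have h1 := Blaser2013_lemma77_claim K h0 s
  have hf : 1 ≤ t ^ N := Nat.one_le_pow _ _ ht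
  calc tensorRank (kroneckerPow (matMulTensor K k m n) (N * (s + 1)))
      = tensorRank (matMulTensor K (k ^ (N * (s + 1))) (m ^ (N * (s + 1))) (n ^ (N * (s + 1)))) :=
        tensorRank_kroneckerPow_matMulTensor K k m n _
    _ = tensorRank (matMulTensor K ((k ^ N) ^ (s + 1)) ((m ^ N) ^ (s + 1)) ((n ^ N) ^ (s + 1))) := by
        rw [pow_mul, pow_mul, pow_mul]
    _ ≤ tensorRank (kroneckerTensor (unitTensor K (t ^ N))
          (matMulTensor K ((k ^ N) ^ (s + 1)) ((m ^ N) ^ (s + 1)) ((n ^ N) ^ (s + 1)))) :=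
        tensorRank_le_tensorRank_multiple hf _
    _ ≤ Q ^ s * (Q * t ^ N) := h1
    _ = Q ^ (s + 1) * t ^ N := by ring

/-- **`R̃(⟨k,m,n⟩) ≤ ⌈R(U^{⊗N}) / t^N⌉^{1/N}`** in the form: `R(U^{⊗N}) ≤ Q t^N`, `N ≥ 1` ⇒
`R̃(⟨k,m,n⟩) ≤ Q^{1/N}` (from the previous bound, `R̃(T) ≤ R(T^{⊗N(s+1)})^{1/(N(s+1))} ≤
Q^{1/N} t^{1/(s+1)}`, and `s → ∞`). [cite: Blaser2013, Lemma 7.7 and Thm. 7.5 (proof)] -/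
theorem asymptoticRank_matMulTensor_le_rpow_of_multiple {t k m n N Q : ℕ} (ht : 1 ≤ t) (hN : 1 ≤ N)
    (hQ : tensorRank (kroneckerPow (kroneckerTensor (unitTensor K t) (matMulTensor K k m n)) N) ≤
      Q * t ^ N) :
    asymptoticRank (matMulTensor K k m n) ≤ (Q : ℝ) ^ ((N : ℝ)⁻¹) := by
  have hN0 : (N : ℝ) ≠ 0 := by exact_mod_cast (by omega : N ≠ 0)
  have ht0 : (0 : ℝ) < t := by exact_mod_cast ht
  have key : ∀ s : ℕ, asymptoticRank (matMulTensor K k m n) ≤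
      (Q : ℝ) ^ ((N : ℝ)⁻¹) * (t : ℝ) ^ (((s : ℝ) + 1)⁻¹) := by
    intro s
    have hs1 : (s : ℝ) + 1 ≠ 0 := by positivity
    have hM : 0 < N * (s + 1) := Nat.mul_pos (by omega) (Nat.succ_pos s)
    have h1 := asymptoticRank_le_rpow (matMulTensor K k m n) hM
    have h2 : (tensorRank (kroneckerPow (matMulTensor K k m n) (N * (s + 1))) : ℝ) ≤
        (Q : ℝ) ^ (s + 1) * (t : ℝ) ^ N := by
      exact_mod_cast tensorRank_kroneckerPow_matMulTensor_le_of_multiple K ht hQ s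
    refine h1.trans ?_
    have hexp : (0 : ℝ) ≤ (((N * (s + 1) : ℕ) : ℝ))⁻¹ := by positivity
    have eQ : ((Q : ℝ) ^ (s + 1)) ^ (((N * (s + 1) : ℕ) : ℝ))⁻¹ = (Q : ℝ) ^ ((N : ℝ)⁻¹) := by
      rw [← Real.rpow_natCast (Q : ℝ) (s + 1), ← Real.rpow_mul (Nat.cast_nonneg Q)]
      congr 1
      push_cast
      field_simp
    have eT : ((t : ℝ) ^ N) ^ (((N * (s + 1) : ℕ) : ℝ))⁻¹ = (t : ℝ) ^ (((s : ℝ) + 1)⁻¹) := by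
      rw [← Real.rpow_natCast (t : ℝ) N, ← Real.rpow_mul ht0.le]
      congr 1
      push_cast
      field_simp
    calc ((tensorRank (kroneckerPow (matMulTensor K k m n) (N * (s + 1))) : ℝ)) ^
          (((N * (s + 1) : ℕ) : ℝ))⁻¹
        ≤ ((Q : ℝ) ^ (s + 1) * (t : ℝ) ^ N) ^ (((N * (s + 1) : ℕ) : ℝ))⁻¹ :=
          Real.rpow_le_rpow (by positivity) h2 hexp
      _ = (Q : ℝ) ^ ((N : ℝ)⁻¹) * (t : ℝ) ^ (((s : ℝ) + 1)⁻¹) := by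
          rw [Real.mul_rpow (by positivity) (by positivity), eQ, eT]
  -- `s → ∞`: `t^{1/(s+1)} → t^0 = 1`
  have hlim : Tendsto (fun s : ℕ => (Q : ℝ) ^ ((N : ℝ)⁻¹) * (t : ℝ) ^ (((s : ℝ) + 1)⁻¹)) atTop
      (𝓝 ((Q : ℝ) ^ ((N : ℝ)⁻¹) * (t : ℝ) ^ (0 : ℝ))) := by
    refine Tendsto.const_mul _ ?_
    have hc : ContinuousAt (fun x : ℝ => (t : ℝ) ^ x) 0 := Real.continuousAt_const_rpow ht0.ne'
    have h0 : Tendsto (fun s : ℕ => ((s : ℝ) + 1)⁻¹) atTop (𝓝 0) := by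
      have := tendsto_one_div_add_atTop_nhds_zero_nat (𝕜 := ℝ)
      simpa [one_div] using this
    exact hc.tendsto.comp h0
  rw [Real.rpow_zero, mul_one] at hlim
  exact ge_of_tendsto' hlim key

/-- **`t · R̃(⟨k,m,n⟩) ≤ R̃(⟨t⟩ ⊗ ⟨k,m,n⟩)`** for `t, k, m, n ≥ 1` — the asymptotic rank is
super-additive (hence additive) on copies of a matrix multiplication tensor; the content of
Schönhage's asymptotic sum inequality with equal summands (Bläser 2013, Thm. 7.5 / Lemma 7.7), here
without passing through `ω`. [cite: AlmanDuanVassilevskaWilliamsXuXuZhou2025, Thm. 3.2] -/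
theorem mul_asymptoticRank_matMulTensor_le {t k m n : ℕ} (ht : 1 ≤ t) (hk : 0 < k) (hm : 0 < m)
    (hn : 0 < n) :
    (t : ℝ) * asymptoticRank (matMulTensor K k m n) ≤
      asymptoticRank (kroneckerTensor (unitTensor K t) (matMulTensor K k m n)) := by
  set U := kroneckerTensor (unitTensor K t) (matMulTensor K k m n) with hU
  set r : ℕ → ℕ := fun N => tensorRank (kroneckerPow U N) with hr
  have ht0 : (0 : ℝ) < t := by exact_mod_cast ht
  -- for `N ≥ 1`: `R̃(T) ≤ 2^{1/N} · r_N^{1/N} / t`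
  have key : ∀ N : ℕ, 1 ≤ N → asymptoticRank (matMulTensor K k m n) ≤
      (2 : ℝ) ^ ((N : ℝ)⁻¹) * ((r N : ℝ) ^ ((N : ℝ)⁻¹) / t) := by
    intro N hN
    have htN : (0 : ℝ) < (t : ℝ) ^ N := pow_pos ht0 N
    set Q : ℕ := ⌈(r N : ℝ) / (t : ℝ) ^ N⌉₊ with hQdef
    have hQ : r N ≤ Q * t ^ N := by
      have h1 : (r N : ℝ) / (t : ℝ) ^ N ≤ Q := Nat.le_ceil _
      rw [div_le_iff₀ htN] at h1
      exact_mod_cast h1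
    have h1 := asymptoticRank_matMulTensor_le_rpow_of_multiple K ht hN hQ
    have hlow : t ^ N ≤ r N := pow_le_tensorRank_kroneckerPow_multiple_matMulTensor K hk hm hn t N
    have hlow' : (1 : ℝ) ≤ (r N : ℝ) / (t : ℝ) ^ N := by
      rw [le_div_iff₀ htN, one_mul]
      exact_mod_cast hlow
    have hQle : (Q : ℝ) ≤ 2 * ((r N : ℝ) / (t : ℝ) ^ N) := by
      have h2 : (Q : ℝ) < (r N : ℝ) / (t : ℝ) ^ N + 1 :=
        Nat.ceil_lt_add_one (le_trans zero_le_one hlow')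
      linarith
    have hN0 : (N : ℝ) ≠ 0 := by exact_mod_cast (by omega : N ≠ 0)
    calc asymptoticRank (matMulTensor K k m n) ≤ (Q : ℝ) ^ ((N : ℝ)⁻¹) := h1
      _ ≤ (2 * ((r N : ℝ) / (t : ℝ) ^ N)) ^ ((N : ℝ)⁻¹) :=
          Real.rpow_le_rpow (Nat.cast_nonneg _) hQle (by positivity)
      _ = (2 : ℝ) ^ ((N : ℝ)⁻¹) * ((r N : ℝ) ^ ((N : ℝ)⁻¹) / t) := by
          rw [Real.mul_rpow (by norm_num) (by positivity), Real.div_rpow (Nat.cast_nonneg _) htN.le]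
          congr 2
          rw [← Real.rpow_natCast (t : ℝ) N, ← Real.rpow_mul ht0.le, mul_inv_cancel₀ hN0,
            Real.rpow_one]
  -- `N → ∞`: `2^{1/N} → 1`, `r_N^{1/N} → R̃(U)` (Fekete)
  have hlim : Tendsto (fun N : ℕ => (2 : ℝ) ^ ((N : ℝ)⁻¹) * ((r N : ℝ) ^ ((N : ℝ)⁻¹) / t)) atTop
      (𝓝 ((2 : ℝ) ^ (0 : ℝ) * (asymptoticRank U / t))) := by
    refine Tendsto.mul ?_ ?_
    · have hc : ContinuousAt (fun x : ℝ => (2 : ℝ) ^ x) 0 :=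
        Real.continuousAt_const_rpow (by norm_num)
      exact hc.tendsto.comp (tendsto_inv_atTop_nhds_zero_nat (𝕜 := ℝ))
    · exact (advxxz2025_asymptoticRank_tendsto U).div_const _
  rw [Real.rpow_zero, one_mul] at hlim
  have hle : asymptoticRank (matMulTensor K k m n) ≤ asymptoticRank U / t :=
    ge_of_tendsto hlim (eventually_atTop.2 ⟨1, fun N hN => key N hN⟩)
  rwa [le_div_iff₀ ht0, mul_comm] at hle

/-- **`R̃(⟨t⟩ ⊗ ⟨k,m,n⟩) = t · R̃(⟨k,m,n⟩)`** (`t, k, m, n ≥ 1`): the asymptotic rank of `t`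
independent copies of a matrix multiplication tensor. [cite: AlmanDuanVassilevskaWilliamsXuXuZhou2025, Thm. 3.2 (with §3.2, R̃ of direct sums)] -/
theorem asymptoticRank_multiple_matMulTensor {t k m n : ℕ} (ht : 1 ≤ t) (hk : 0 < k) (hm : 0 < m)
    (hn : 0 < n) :
    asymptoticRank (kroneckerTensor (unitTensor K t) (matMulTensor K k m n)) =
      t * asymptoticRank (matMulTensor K k m n) :=
  le_antisymm (asymptoticRank_multiple_le K t _) (mul_asymptoticRank_matMulTensor_le K ht hk hm hn)

/-- **ADVXXZ 2025, Theorem 3.2 (Schönhage's asymptotic sum inequality for `ω(a,b,c)`)**: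
`t · q^{ω(a,b,c)} ≤ R̃(⊕_{i=1}^t ⟨q^a, q^b, q^c⟩)` for positive integers `t` and `q ≥ 2` and
natural exponents `a, b, c` (`⊕^t = ⟨t⟩ ⊗ ·`; `ω(a,b,c) = omegaRect K a b c`, for which
`R̃(⟨q^a,q^b,q^c⟩) = q^{ω(a,b,c)}`). [cite: AlmanDuanVassilevskaWilliamsXuXuZhou2025, Thm. 3.2] -/
theorem advxxz2025_thm32 {q : ℕ} (hq : 2 ≤ q) (a b c : ℕ) {t : ℕ} (ht : 1 ≤ t) :
    (t : ℝ) * (q : ℝ) ^ omegaRect K a b c ≤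
      asymptoticRank (kroneckerTensor (unitTensor K t) (matMulTensor K (q ^ a) (q ^ b) (q ^ c))) := by
  rw [← asymptoticRank_matMulTensor_rect K hq a b c]
  have hq0 : 0 < q := by omega
  exact mul_asymptoticRank_matMulTensor_le K ht (pow_pos hq0 a) (pow_pos hq0 b) (pow_pos hq0 c)

/-- Theorem 3.2 holds with equality: `R̃(⊕^t ⟨q^a, q^b, q^c⟩) = t · q^{ω(a,b,c)}`.
[cite: AlmanDuanVassilevskaWilliamsXuXuZhou2025, Thm. 3.2 and §3.4] -/
theorem advxxz2025_thm32_eq {q : ℕ} (hq : 2 ≤ q) (a b c : ℕ) {t : ℕ} (ht : 1 ≤ t) :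
    asymptoticRank (kroneckerTensor (unitTensor K t) (matMulTensor K (q ^ a) (q ^ b) (q ^ c))) =
      (t : ℝ) * (q : ℝ) ^ omegaRect K a b c := by
  rw [← asymptoticRank_matMulTensor_rect K hq a b c]
  have hq0 : 0 < q := by omega
  exact asymptoticRank_multiple_matMulTensor K ht (pow_pos hq0 a) (pow_pos hq0 b) (pow_pos hq0 c)

/-- The cubic case: **`R̃(⊕^t ⟨q,q,q⟩) = t · q^ω`** (`t, q ≥ 1`). [cite: AlmanDuanVassilevskaWilliamsXuXuZhou2025, Thm. 3.1–3.2 and §3.4 (R̃(⟨q,q,q⟩) = q^ω)] -/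
theorem asymptoticRank_multiple_matMulTensor_cube {q t : ℕ} (hq : 1 ≤ q) (ht : 1 ≤ t) :
    asymptoticRank (kroneckerTensor (unitTensor K t) (matMulTensor K q q q)) =
      (t : ℝ) * (q : ℝ) ^ omega K := by
  rw [← asymptoticRank_matMulTensor K q hq]
  exact asymptoticRank_multiple_matMulTensor K ht (by omega) (by omega) (by omega)

end MultiplesMatMul

end Literature.Computability.AlgebraicComplexity

end
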